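import Summits.AtomisticToContinuum.HydrodynamicLimit.Theorems.CollisionIsometryCLTAdaptedWeightCLTTimeLocal

/-!
# Stub `stub_sourceContraction` of the line `contact-source-duhamel`, helper file 1:
the correlation identity and the two-sided Peter–Paul sandwich
(crux `CollisionIsometryCLT.AdaptedWeightCLT`, stmt-AtomisticToContinuum-14868, rev-12 TIME-LOCAL
crux; `--supports`; namespace `…ContactSourceDuhamel.TimeLocal.SourceContraction`)

AUDIT of the typed closure statement `SourceContractionOn σ a₀ θ₀ u₀ Φ t`
(`∀ kernels ∃ κ < 1 ∀ δ > 0, P_N{κ ∫₀ᵗ∫ₓ DefectSq + δ < ∫₀ᵗ∫ₓ XiCorr} → 0`). Exact algebra only; no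
definitions, no measure theory.

On the flow-dictionary event at `z` and under the Duhamel identity, for every kernel family `φ`,
time `s` and point `x`, the block moment of every test splits as `Blk = PAST + Ξ`
(`blkFlow_eq_pastF_add_xiF`), hence the CHAOS VALUE correlation is, identically,
  `XiCorr = DefectSq − Σ_tests Blk · PAST − Σ_tests Blk · (Ξ − Ξ^ch)`                 (`xiCorr_eq`)
and by Peter–Paul (`|Σ aᵢbᵢ| ≤ η Σ aᵢ² + (4η)⁻¹ Σ bᵢ²`) for every `η > 0`
  `(1 − 2η) DefectSq − (4η)⁻¹ (PastSq + XiDevSq) ≤ XiCorr ≤ (1 + 2η) DefectSq + (4η)⁻¹ (PastSq + XiDevSq)`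
(`le_xiCorr`, `xiCorr_le`, `abs_xiCorr_sub_defectSq_le`); in particular `XiCorr = DefectSq` wherever
`PastSq = 0 = XiDevSq` (`xiCorr_eq_defectSq`; registered anchor `sc_xiCorr_eq_defectSq`).

Consequence for the line (real arithmetic: `sc_event_of_defect_gt`, `defect_gt_or_of_sc_event`; the
integrated form is `stub_reduction`'s integrability bookkeeping and is not asserted here): writing
`D, X, P, V` for `∫₀ᵗ∫ₓ` of `DefectSq, XiCorr, PastSq, XiDevSq`,
  `{D > δ'} ∩ {P ≤ ε} ∩ {V ≤ ε} ⊆ {κD + δ < X}`           (`κ + 2η < 1`, `δ = (1 − 2η − κ)δ' − ε/(2η)`),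
  `{κD + δ < X} ⊆ {D > δ/(2(1 + 2η − κ))} ∪ {P > ηδ} ∪ {V > ηδ}`                      (every `κ < 1`).
So, given the neighbours' conclusions `PastSmallOn t`, `CrossNullOn t` and the two exact inputs, the
typed `SourceContractionOn … t` is, for EVERY `κ < 1`, equivalent to `∫₀ᵗ∫ₓ DefectSq → 0` in
probability, i.e. to the crux's conclusion `ConclOn … t` itself: there is no `κ`-margin (the statement
at `κ = 1 − ε` is exactly as strong as at `κ = −1/2`), and no choice of `κ` turns it into bookkeeping
from `PastSmallOn ∧ CrossNullOn ∧ TailsOn`.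

-- adapted from Theorems/CollisionIsometryCLTAdaptedWeightCLTStubReductionDictionary.lean
(the pairing algebra and `blkF = pastF + xiF` inside `blkFlow_eq_pastF_add_xiF`: that module imports the
rev-11 statements module, which no longer elaborates since route rev 12 and cannot be amended
append-only; the argument is re-homed here against `TimeLocal.DuhamelIdentity`).
-/

namespace Summit.AtomisticToContinuum.HydrodynamicLimit.Theorems.ContactSourceDuhamel.TimeLocal
namespace SourceContraction

open scoped BigOperators Topology Classical MeasureTheory ENNReal InnerProductSpace
open Filter Set MeasureTheory

noncomputable section

variable {σ : ℝ} {N : ℕ}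

/-! ## `Blk = PAST + Ξ` on the dictionary event -/

/-- `Blk = PAST + Ξ` for the flow-side block moment of every test of positive rank, on the
dictionary event and under the Duhamel identity: the dictionary turns `blkFlow` into the fold-side
block moment of the fold restarted at the window start (`sub_add_cancel`), and the Duhamel identity,
evaluated at each particle, paired with `C`, weighted and averaged, splits it. -/
theorem blkFlow_eq_pastF_add_xiF (hDu : DuhamelIdentity σ) {Φ : Flow σ N} {z : Cfg N}
    (hz : ∀ s Δ : ℝ, 0 ≤ Δ →
      (fun i => (Φ.flow (s + Δ) z i).2) = velAfter σ N (Φ.flow s z) (steps σ N (Φ.flow s z) Δ))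
    (φ : ℕ → T3 → ℝ) {r : ℕ} (hr : 0 < r) (s : ℝ) (x : T3) (C : Tens r) :
    blkFlow r σ N Φ φ s z x C =
      pastF r σ N (winStart σ N Φ s z) (steps σ N (winStart σ N Φ s z) (winLen N s))
          (wgt σ N Φ φ s z x) (ubar σ N Φ φ s z x) C +
        xiF r σ N (winStart σ N Φ s z) (steps σ N (winStart σ N Φ s z) (winLen N s))
          (wgt σ N Φ φ s z x) (ubar σ N Φ φ s z x) C := by
  -- pairing algebra (adapted from the rev-11 dictionary file)
  have pairT_add : ∀ A B : Tens r, pairT C (A + B) = pairT C A + pairT C B := fun A B => by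
    simp only [pairT, Pi.add_apply, mul_add, Finset.sum_add_distrib]
  have pairT_sum : ∀ (S : Finset ℕ) (F : ℕ → Tens r),
      pairT C (∑ l ∈ S, F l) = ∑ l ∈ S, pairT C (F l) := fun S F => by
    simp only [pairT, Finset.sum_apply, Finset.mul_sum]
    rw [Finset.sum_comm]
  -- the window is nonnegative, so the dictionary applies over `[s - winLen, s]`
  have hwin : 0 ≤ winLen N s := by
    unfold winLen Δℓ
    split_ifs
    · exact le_rfl
    · exact mul_nonneg (Real.rpow_nonneg (by positivity) _) (Real.log_nonneg (by linarith))
  have h : (fun i => (Φ.flow s z i).2) =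
      velAfter σ N (winStart σ N Φ s z) (steps σ N (winStart σ N Φ s z) (winLen N s)) := by
    have := hz (s - winLen N s) (winLen N s) hwin
    rwa [sub_add_cancel] at this
  -- the Duhamel identity of the restarted fold
  have hD := hDu r N (winStart σ N Φ s z) (ubar σ N Φ φ s z x)
    (steps σ N (winStart σ N Φ s z) (winLen N s)) hr
  unfold blkFlow pastF xiF
  rw [Finset.sum_comm, ← mul_add, ← Finset.sum_add_distrib]
  congr 1
  refine Finset.sum_congr rfl fun i _ => ?_
  rw [show (Φ.flow s z i).2 = _ from congrFun h i,
    show tpow r (velAfter σ N (winStart σ N Φ s z) (steps σ N (winStart σ N Φ s z) (winLen N s)) i -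
      ubar σ N Φ φ s z x) = _ from congrFun hD i,
    Pi.add_apply, Finset.sum_apply, pairT_add, pairT_sum, mul_add, Finset.mul_sum]

/-! ## The correlation identity -/

/-- One test: `B = P + X` gives `B · Xc = B² − B·P − B·(X − Xc)`. -/
theorem mul_chaos_eq {B P X Xc : ℝ} (hB : B = P + X) :
    B * Xc = B ^ 2 - B * P - B * (X - Xc) := by
  subst hB
  ring

/-- **THE CORRELATION IDENTITY.** On the dictionary event and under the Duhamel identity, for every
kernel family, time and point:
`XiCorr = DefectSq − Σ_tests Blk · PAST − Σ_tests Blk · (Ξ − Ξ^ch)` — the correlation of the chaos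
value of the source sums with the current block moments IS `|D|² + |q|²` minus the two cross
correlations that the neighbours (`PastSmallOn`, `CrossNullOn`) make small. -/
theorem xiCorr_eq (hDu : DuhamelIdentity σ) {Φ : Flow σ N} {z : Cfg N}
    (hz : ∀ s Δ : ℝ, 0 ≤ Δ →
      (fun i => (Φ.flow (s + Δ) z i).2) = velAfter σ N (Φ.flow s z) (steps σ N (Φ.flow s z) Δ))
    (φ : ℕ → T3 → ℝ) (s : ℝ) (x : T3) :
    XiCorr σ N Φ φ s z x = DefectSq σ N Φ φ s z x -
      ((∑ j : Fin 3, ∑ k : Fin 3,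
          blkFlow 2 σ N Φ φ s z x (C2 j k) *
            pastF 2 σ N (winStart σ N Φ s z) (steps σ N (winStart σ N Φ s z) (winLen N s))
              (wgt σ N Φ φ s z x) (ubar σ N Φ φ s z x) (C2 j k)) +
        ∑ a : Fin 3,
          blkFlow 3 σ N Φ φ s z x (C3 a) *
            pastF 3 σ N (winStart σ N Φ s z) (steps σ N (winStart σ N Φ s z) (winLen N s))
              (wgt σ N Φ φ s z x) (ubar σ N Φ φ s z x) (C3 a)) -
      ((∑ j : Fin 3, ∑ k : Fin 3,
          blkFlow 2 σ N Φ φ s z x (C2 j k) *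
            (xiF 2 σ N (winStart σ N Φ s z) (steps σ N (winStart σ N Φ s z) (winLen N s))
                (wgt σ N Φ φ s z x) (ubar σ N Φ φ s z x) (C2 j k) -
              xiChF 2 σ N (winStart σ N Φ s z) (steps σ N (winStart σ N Φ s z) (winLen N s))
                (wgt σ N Φ φ s z x) (ubar σ N Φ φ s z x) (C2 j k))) +
        ∑ a : Fin 3,
          blkFlow 3 σ N Φ φ s z x (C3 a) *
            (xiF 3 σ N (winStart σ N Φ s z) (steps σ N (winStart σ N Φ s z) (winLen N s))
                (wgt σ N Φ φ s z x) (ubar σ N Φ φ s z x) (C3 a) -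
              xiChF 3 σ N (winStart σ N Φ s z) (steps σ N (winStart σ N Φ s z) (winLen N s))
                (wgt σ N Φ φ s z x) (ubar σ N Φ φ s z x) (C3 a))) := by
  have h2 : ∀ j k : Fin 3, _ := fun j k =>
    mul_chaos_eq (Xc := xiChF 2 σ N (winStart σ N Φ s z) (steps σ N (winStart σ N Φ s z) (winLen N s))
      (wgt σ N Φ φ s z x) (ubar σ N Φ φ s z x) (C2 j k))
      (blkFlow_eq_pastF_add_xiF hDu hz φ two_pos s x (C2 j k))
  have h3 : ∀ a : Fin 3, _ := fun a =>
    mul_chaos_eq (Xc := xiChF 3 σ N (winStart σ N Φ s z) (steps σ N (winStart σ N Φ s z) (winLen N s))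
      (wgt σ N Φ φ s z x) (ubar σ N Φ φ s z x) (C3 a))
      (blkFlow_eq_pastF_add_xiF hDu hz φ three_pos s x (C3 a))
  unfold XiCorr DefectSq
  simp only [h2, h3, Finset.sum_sub_distrib]
  ring

/-! ## Peter–Paul and the two-sided sandwich -/

/-- `|a b| ≤ η a² + (4η)⁻¹ b²` for `η > 0`. -/
theorem abs_mul_le_peterPaul {η : ℝ} (hη : 0 < η) (a b : ℝ) :
    |a * b| ≤ η * a ^ 2 + (4 * η)⁻¹ * b ^ 2 := by
  have h4 : 0 < 4 * η := by positivity
  rw [abs_le]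
  constructor
  · have key : 0 ≤ 4 * η * (η * a ^ 2 + a * b) + b ^ 2 := by nlinarith [sq_nonneg (2 * η * a + b)]
    have : η * a ^ 2 + (4 * η)⁻¹ * b ^ 2 + a * b =
        (4 * η)⁻¹ * (4 * η * (η * a ^ 2 + a * b) + b ^ 2) := by
      field_simp
      ring
    nlinarith [mul_nonneg (inv_nonneg.2 h4.le) key]
  · have key : 0 ≤ 4 * η * (η * a ^ 2 - a * b) + b ^ 2 := by nlinarith [sq_nonneg (2 * η * a - b)]
    have : η * a ^ 2 + (4 * η)⁻¹ * b ^ 2 - a * b =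
        (4 * η)⁻¹ * (4 * η * (η * a ^ 2 - a * b) + b ^ 2) := by
      field_simp
      ring
    nlinarith [mul_nonneg (inv_nonneg.2 h4.le) key]

/-- Summed Peter–Paul: `|Σ aᵢ bᵢ| ≤ η Σ aᵢ² + (4η)⁻¹ Σ bᵢ²`. -/
theorem abs_sum_mul_le_peterPaul {ι : Type*} (S : Finset ι) {η : ℝ} (hη : 0 < η) (a b : ι → ℝ) :
    |∑ i ∈ S, a i * b i| ≤ η * ∑ i ∈ S, a i ^ 2 + (4 * η)⁻¹ * ∑ i ∈ S, b i ^ 2 := by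
  calc |∑ i ∈ S, a i * b i| ≤ ∑ i ∈ S, |a i * b i| := Finset.abs_sum_le_sum_abs _ _
    _ ≤ ∑ i ∈ S, (η * a i ^ 2 + (4 * η)⁻¹ * b i ^ 2) :=
        Finset.sum_le_sum fun i _ => abs_mul_le_peterPaul hη (a i) (b i)
    _ = η * ∑ i ∈ S, a i ^ 2 + (4 * η)⁻¹ * ∑ i ∈ S, b i ^ 2 := by
        rw [Finset.sum_add_distrib, Finset.mul_sum, Finset.mul_sum]

/-- Doubly summed Peter–Paul (the stress channel is indexed by `j k : Fin 3`). -/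
theorem abs_sum_sum_mul_le_peterPaul {ι κ : Type*} (S : Finset ι) (T : Finset κ) {η : ℝ}
    (hη : 0 < η) (a b : ι → κ → ℝ) :
    |∑ i ∈ S, ∑ j ∈ T, a i j * b i j| ≤
      η * ∑ i ∈ S, ∑ j ∈ T, a i j ^ 2 + (4 * η)⁻¹ * ∑ i ∈ S, ∑ j ∈ T, b i j ^ 2 := by
  calc |∑ i ∈ S, ∑ j ∈ T, a i j * b i j| ≤ ∑ i ∈ S, |∑ j ∈ T, a i j * b i j| :=
        Finset.abs_sum_le_sum_abs _ _
    _ ≤ ∑ i ∈ S, (η * ∑ j ∈ T, a i j ^ 2 + (4 * η)⁻¹ * ∑ j ∈ T, b i j ^ 2) :=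
        Finset.sum_le_sum fun i _ => abs_sum_mul_le_peterPaul T hη (a i) (b i)
    _ = η * ∑ i ∈ S, ∑ j ∈ T, a i j ^ 2 + (4 * η)⁻¹ * ∑ i ∈ S, ∑ j ∈ T, b i j ^ 2 := by
        rw [Finset.sum_add_distrib, Finset.mul_sum, Finset.mul_sum]

/-- **THE SANDWICH.** On the dictionary event and under the Duhamel identity, for every `η > 0`,
`|XiCorr − DefectSq| ≤ 2η DefectSq + (4η)⁻¹ (PastSq + XiDevSq)`: Peter–Paul applied to the two cross
correlations of `xiCorr_eq`, channel by channel. -/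
theorem abs_xiCorr_sub_defectSq_le (hDu : DuhamelIdentity σ) {Φ : Flow σ N} {z : Cfg N}
    (hz : ∀ s Δ : ℝ, 0 ≤ Δ →
      (fun i => (Φ.flow (s + Δ) z i).2) = velAfter σ N (Φ.flow s z) (steps σ N (Φ.flow s z) Δ))
    (φ : ℕ → T3 → ℝ) {η : ℝ} (hη : 0 < η) (s : ℝ) (x : T3) :
    |XiCorr σ N Φ φ s z x - DefectSq σ N Φ φ s z x| ≤ 2 * η * DefectSq σ N Φ φ s z x +
      (4 * η)⁻¹ * (PastSq σ N Φ φ s z x + XiDevSq σ N Φ φ s z x) := by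
  -- Peter–Paul for the four pieces (stress / heat-flux channel × past / chaos defect)
  have hP2 := abs_sum_sum_mul_le_peterPaul Finset.univ Finset.univ hη
    (fun j k => blkFlow 2 σ N Φ φ s z x (C2 j k))
    (fun j k => pastF 2 σ N (winStart σ N Φ s z) (steps σ N (winStart σ N Φ s z) (winLen N s))
      (wgt σ N Φ φ s z x) (ubar σ N Φ φ s z x) (C2 j k))
  have hP3 := abs_sum_mul_le_peterPaul Finset.univ hη (fun a => blkFlow 3 σ N Φ φ s z x (C3 a))
    (fun a => pastF 3 σ N (winStart σ N Φ s z) (steps σ N (winStart σ N Φ s z) (winLen N s))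
      (wgt σ N Φ φ s z x) (ubar σ N Φ φ s z x) (C3 a))
  have hV2 := abs_sum_sum_mul_le_peterPaul Finset.univ Finset.univ hη
    (fun j k => blkFlow 2 σ N Φ φ s z x (C2 j k))
    (fun j k => xiF 2 σ N (winStart σ N Φ s z) (steps σ N (winStart σ N Φ s z) (winLen N s))
        (wgt σ N Φ φ s z x) (ubar σ N Φ φ s z x) (C2 j k) -
      xiChF 2 σ N (winStart σ N Φ s z) (steps σ N (winStart σ N Φ s z) (winLen N s))
        (wgt σ N Φ φ s z x) (ubar σ N Φ φ s z x) (C2 j k))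
  have hV3 := abs_sum_mul_le_peterPaul Finset.univ hη (fun a => blkFlow 3 σ N Φ φ s z x (C3 a))
    (fun a => xiF 3 σ N (winStart σ N Φ s z) (steps σ N (winStart σ N Φ s z) (winLen N s))
        (wgt σ N Φ φ s z x) (ubar σ N Φ φ s z x) (C3 a) -
      xiChF 3 σ N (winStart σ N Φ s z) (steps σ N (winStart σ N Φ s z) (winLen N s))
        (wgt σ N Φ φ s z x) (ubar σ N Φ φ s z x) (C3 a))
  rw [abs_le] at hP2 hP3 hV2 hV3
  rw [xiCorr_eq hDu hz φ s x, abs_le]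
  unfold DefectSq PastSq XiDevSq
  constructor
  · nlinarith [hP2.2, hP3.2, hV2.2, hV3.2]
  · nlinarith [hP2.1, hP3.1, hV2.1, hV3.1]

/-- UPPER HALF OF THE SANDWICH (the converse of `stub_reduction`'s pointwise step):
`XiCorr ≤ (1 + 2η) DefectSq + (4η)⁻¹ (PastSq + XiDevSq)`. -/
theorem xiCorr_le (hDu : DuhamelIdentity σ) {Φ : Flow σ N} {z : Cfg N}
    (hz : ∀ s Δ : ℝ, 0 ≤ Δ →
      (fun i => (Φ.flow (s + Δ) z i).2) = velAfter σ N (Φ.flow s z) (steps σ N (Φ.flow s z) Δ))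
    (φ : ℕ → T3 → ℝ) {η : ℝ} (hη : 0 < η) (s : ℝ) (x : T3) :
    XiCorr σ N Φ φ s z x ≤ (1 + 2 * η) * DefectSq σ N Φ φ s z x +
      (4 * η)⁻¹ * (PastSq σ N Φ φ s z x + XiDevSq σ N Φ φ s z x) := by
  have h := (abs_le.1 (abs_xiCorr_sub_defectSq_le hDu hz φ hη s x)).2
  linarith

/-- LOWER HALF OF THE SANDWICH (`stub_reduction`'s pointwise step, rearranged):
`(1 − 2η) DefectSq − (4η)⁻¹ (PastSq + XiDevSq) ≤ XiCorr`. -/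
theorem le_xiCorr (hDu : DuhamelIdentity σ) {Φ : Flow σ N} {z : Cfg N}
    (hz : ∀ s Δ : ℝ, 0 ≤ Δ →
      (fun i => (Φ.flow (s + Δ) z i).2) = velAfter σ N (Φ.flow s z) (steps σ N (Φ.flow s z) Δ))
    (φ : ℕ → T3 → ℝ) {η : ℝ} (hη : 0 < η) (s : ℝ) (x : T3) :
    (1 - 2 * η) * DefectSq σ N Φ φ s z x -
        (4 * η)⁻¹ * (PastSq σ N Φ φ s z x + XiDevSq σ N Φ φ s z x) ≤ XiCorr σ N Φ φ s z x := by
  have h := (abs_le.1 (abs_xiCorr_sub_defectSq_le hDu hz φ hη s x)).1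
  linarith

/-! ## The ideal regime: no past, no chaos defect -/

/-- **IDEAL REGIME.** On the dictionary event and under the Duhamel identity: wherever the past is
fully damped (`PastSq = 0`) and the source sums equal their chaos values (`XiDevSq = 0`), the chaos
value correlation IS the defect: `XiCorr = DefectSq = |D|² + |q|²` (let `η → 0` in the sandwich).
There the source-contraction event `{κ ∫∫DefectSq + δ < ∫∫XiCorr}` reads `{(1 − κ) ∫∫DefectSq > δ}`
for every `κ`. -/
theorem xiCorr_eq_defectSq (hDu : DuhamelIdentity σ) {Φ : Flow σ N} {z : Cfg N}
    (hz : ∀ s Δ : ℝ, 0 ≤ Δ →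
      (fun i => (Φ.flow (s + Δ) z i).2) = velAfter σ N (Φ.flow s z) (steps σ N (Φ.flow s z) Δ))
    (φ : ℕ → T3 → ℝ) (s : ℝ) (x : T3) (hP : PastSq σ N Φ φ s z x = 0)
    (hV : XiDevSq σ N Φ φ s z x = 0) : XiCorr σ N Φ φ s z x = DefectSq σ N Φ φ s z x := by
  have hD : 0 ≤ DefectSq σ N Φ φ s z x := by
    unfold DefectSq
    exact add_nonneg (Finset.sum_nonneg fun j _ => Finset.sum_nonneg fun k _ => sq_nonneg _)
      (Finset.sum_nonneg fun a _ => sq_nonneg _)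
  have key : ∀ ε : ℝ, 0 < ε → |XiCorr σ N Φ φ s z x - DefectSq σ N Φ φ s z x| ≤ 0 + ε := by
    intro ε hε
    have hη : 0 < ε / (2 * DefectSq σ N Φ φ s z x + 2) := by positivity
    refine (abs_xiCorr_sub_defectSq_le hDu hz φ hη s x).trans ?_
    rw [hP, hV, add_zero, mul_zero, add_zero, zero_add, mul_assoc, mul_comm, mul_assoc,
      div_mul_eq_mul_div, div_le_iff₀ (by positivity)]
    nlinarith
  rw [← sub_eq_zero, ← abs_nonpos_iff]
  exact le_of_forall_pos_le_add key

/-! ## Event bookkeeping (real arithmetic): what the sandwich does to the source-contraction event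

With `D = ∫∫DefectSq ≥ 0`, `X = ∫∫XiCorr`, `P = ∫∫PastSq`, `V = ∫∫XiDevSq` of one configuration
(once the integrals are split, which is `stub_reduction`'s integrability bookkeeping), the
source-contraction bad event is `{κ D + δ < X}`. -/

/-- LOWER EVENT INCLUSION (the logic of `stub_reduction`): under the lower half of the sandwich, if
`κ + 2η < 1`, a defect above `δ'` with past and chaos defect below `ε` FORCES the source-contraction
event at level `(1 − 2η − κ) δ' − ε/(2η)`; so `{D > δ'} ⊆ {κD + δ < X} ∪ {P > ε} ∪ {V > ε}`. -/
theorem sc_event_of_defect_gt {D X P V η κ δ' ε : ℝ} (hη : 0 < η) (hκ : κ + 2 * η < 1)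
    (hlow : (1 - 2 * η) * D - (4 * η)⁻¹ * (P + V) ≤ X) (hD : δ' < D) (hP : P ≤ ε) (hV : V ≤ ε) :
    κ * D + ((1 - 2 * η - κ) * δ' - (2 * η)⁻¹ * ε) < X := by
  have h4 : (4 * η)⁻¹ * (P + V) ≤ (2 * η)⁻¹ * ε := by
    rw [show (2 * η)⁻¹ * ε = (4 * η)⁻¹ * (2 * ε) by field_simp; ring]
    exact mul_le_mul_of_nonneg_left (by linarith) (inv_nonneg.2 (by positivity))
  nlinarith [mul_pos (show 0 < 1 - 2 * η - κ by linarith) (sub_pos.2 hD)]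

/-- UPPER EVENT INCLUSION (the converse): under the upper half of the sandwich, the
source-contraction event at level `δ` forces a defect above `δ / (2(1 + 2η − κ))` or a past or a chaos
defect above `η δ`; so `{κD + δ < X} ⊆ {D > δ/(2(1 + 2η − κ))} ∪ {P > ηδ} ∪ {V > ηδ}` — for EVERY `κ < 1`
the source-contraction statement follows from the conclusion `D → 0` and the neighbours, with no
`κ`-margin to spare or to exploit. -/
theorem defect_gt_or_of_sc_event {D X P V η κ δ : ℝ} (hη : 0 < η) (hκ : κ < 1)
    (hup : X ≤ (1 + 2 * η) * D + (4 * η)⁻¹ * (P + V)) (h : κ * D + δ < X) :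
    δ / (2 * (1 + 2 * η - κ)) < D ∨ η * δ < P ∨ η * δ < V := by
  by_contra hc
  simp only [not_or, not_lt] at hc
  obtain ⟨hD, hP, hV⟩ := hc
  have hk : 0 < 1 + 2 * η - κ := by linarith
  have hD' : (1 + 2 * η - κ) * D ≤ δ / 2 := by
    have := (le_div_iff₀ (by positivity : (0 : ℝ) < 2 * (1 + 2 * η - κ))).1 hD
    linarith
  have h4 : (4 * η)⁻¹ * (P + V) ≤ δ / 2 := by
    rw [show δ / 2 = (4 * η)⁻¹ * (2 * (η * δ)) by field_simp; ring]
    exact mul_le_mul_of_nonneg_left (by linarith) (inv_nonneg.2 (by positivity))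
  nlinarith

/-! ## Registered anchor -/

/-- Registered anchor of this helper file (`sc_xiCorr_eq_defectSq`): the ideal-regime identity
`XiCorr = DefectSq` under the Duhamel identity, on the dictionary event, wherever
`PastSq = 0 = XiDevSq`. -/
theorem sc_xiCorr_eq_defectSq : ∀ (σ : ℝ) (N : ℕ) (Φ : Flow σ N) (z : Cfg N), DuhamelIdentity σ →
    (∀ s Δ : ℝ, 0 ≤ Δ →
      (fun i => (Φ.flow (s + Δ) z i).2) = velAfter σ N (Φ.flow s z) (steps σ N (Φ.flow s z) Δ)) →
    ∀ (φ : ℕ → T3 → ℝ) (s : ℝ) (x : T3), PastSq σ N Φ φ s z x = 0 → XiDevSq σ N Φ φ s z x = 0 →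
      XiCorr σ N Φ φ s z x = DefectSq σ N Φ φ s z x :=
  fun _ _ _ _ hDu hz φ s x hP hV => xiCorr_eq_defectSq hDu hz φ s x hP hV

end

end SourceContraction
end Summit.AtomisticToContinuum.HydrodynamicLimit.Theorems.ContactSourceDuhamel.TimeLocal
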